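import Summits.BirchSwinnertonDyer.BirchSwinnertonDyer.Theorems.KolyvaginRoadThreeZhangSupplyJumpAdapter
import Summits.BirchSwinnertonDyer.BirchSwinnertonDyer.Theorems.KolyvaginRoadThreeZhangSupplyJumpInclusion
import Summits.BirchSwinnertonDyer.BirchSwinnertonDyer.Theorems.KolyvaginRoadThreeZhangSupplyLocalH1CardKolyvagin
import Summits.BirchSwinnertonDyer.BirchSwinnertonDyer.Theorems.KolyvaginRoadThreeMethod2InductionOfLevelSystemsDict
import Summits.BirchSwinnertonDyer.Rank1Residual.X11b.KummerRelaxedStructures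
import Summits.BirchSwinnertonDyer.Rank1Residual.X11b.KummerPoitouTateExact
import Summits.BirchSwinnertonDyer.Rank1Residual.X11b.BDPRouteSelmerLevelBound
import Summits.BirchSwinnertonDyer.Rank1Residual.GaloisImage.LocalEulerPoincareCharacteristicHolds
import HarnessLib

/-!
# Route `KolyvaginRoadThree`, deciding crux `ZhangSharpFrameAtThreeHL` (item stmt-BirchSwinnertonDyer-19574):
# the (J) binder `hjump` of S2-ENGINE's (Supply) from TWO local Lagrangian inputs — the Poitou–Tate model Selmer
# structures of part XIV CONSTRUCTED (cell `bsd-stepL`, ACCEL seat `bsd-stepL-koly3b` g6;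
# `--supports stmt-BirchSwinnertonDyer-19574`, helper; part XVIII of the `KolyvaginRoadThreeZhangSupply*` series)

HONEST FRAMING. Theorems only; 0 definitions, 0 named facts, 0 `sorry`; CONDITIONAL on the named Poitou–Tate fact
`poitouTate_selmerStructure_duality K` and on two LOCAL inputs (below); closes nothing (T7). PARTITION: O2@3 (B10) ×
A1 × crux 19574 × the S2-ENGINE's (Supply) binder — proves-glue ∕ types-the-object-of.

WHAT. Part XIV (`hjump_of_lagrangian`, p511335) derives the clause of the binder `hjump` of part XIII
(`supply_signed_of_jump_bound`) at `(n, ℓ, T)` from an ABSTRACT pair of Selmer structures `𝓕 ≤ 𝓖` on `E[3]` with a list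
of side conditions (`T′`, `hS`, unramified outside `S(T′)`, `heq` ∕ `hstrict` ∕ `hrelax`, finiteness, the LAGRANGIAN
property `hmax` off `λ`, `hw`, `hincl`). This file CONSTRUCTS that pair from X11b's Kummer structure
`𝓚 = (E/K).kummerSelmerStructure 3` and two place-indexed families of GENUINE local conditions `Lord v`, `Ltr v ≤
H¹(K_v, E[3])` (Poitou–Tate model `galoisCohomology (ρ.toLocal v) 1`):
`𝓕 ∕ 𝓖 := 𝓚` at `∞` and at the finite places off `λ ∪ plK(T) ∪ {v ∣ n}`; `Ltr v` at `v ∈ plK(T)`; `Lord v` above the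
primes of the level `n`; `⊥ ∕ ⊤` at `λ = plK ℓ` — and DISCHARGES every side condition:
* `T′ := {v ∣ 3} ∪ {bad v} ∪ {λ} ∪ plK(T) ∪ {v ∣ n}` (finite); `hS` (`3 ∉ v`, `E[3]` unramified at good `v ∤ 3`:
  X11b `isUnramifiedAt_torsionGaloisModule`); unramified outside `S(T′)` (X11b `kummerSelmerStructure_inr_eq_
  unramifiedSubgroup`); `heq` ∕ `hstrict` ∕ `hrelax` by construction;
* finiteness: `H¹_𝓕 ⊆ H¹_{𝓚 relaxed on S(T′)} = kummerOutside` (X11b `selmerGroup_kummerRelaxed`, `finite_kummerOutside`);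
* `hmax` at the Kummer places (finite AND complex): X11b `annRight_invWeilPairing_kummerSelmerStructure_eq` with Tate's
  local Euler characteristic PROVED in the tree (`localEulerPoincareCharacteristic_holds`); at the modified places:
  §1 `annRight_invWeilPairing_eq_of_isotropic_of_card` (isotropy + `#L² = #H¹(K_v, E[3])` ⟹ Lagrangian; counting with
  X11b `natCard_annRight_mul` ∕ `invWeilPairing_flip_bijective`);
* `hw` = part XVII (`#H¹(K_λ, E[3]) = 81 > 9`); `hincl` = part XVI from the per-place dictionaries.
RESULT `hjump_of_localLagrangians`: the binder `hjump` of part XIII holds VERBATIM (all good levels `n`, Kolyvagin `ℓ ∉ T`)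
given `IsImaginaryQuadratic K`, the PT fact, the places `plK` (`hplK`), and EXACTLY TWO local inputs, each in
cup-product currency for every Weil-type pairing `e` on `E[3]` (isotropy) plus a cardinality and a one-sided dictionary:
(Lag-ord) above every GOOD unipotent-admissible `q` (`FrobSqNeOneAt`): `Lord v` isotropic, `#Lord v · #Lord v =
#H¹(K_v, E[3])`, `loc_v⁻¹(Lord v) ⊆ ordinaryLocalKer_v`; (Lag-tr) at the place of every Kolyvagin prime `ℓ′`: `Ltr (plK ℓ′)`
isotropic, `#Ltr · #Ltr = #H¹(K_λ′, E[3])` (`= 81`, part XVII), `loc⁻¹(Ltr) ⊆ transverseLocalKer`. With part XIII: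
`hSupply` ⟸ {capstone apparatus, (Lag-ord), (Lag-tr), (IsoBound) `hbound`} modulo the PT fact.

References: [cite: WZhang2014, Lemma 8.2] [cite: McCallumLMS1991, Prop. 2.1 (p. 296)] [cite: MilneADT2006, Ch. I,
Cor. 2.3, Thm. 2.8, Cor. 3.4, Thm. 4.10, Lemma 6.15] [cite: Howard2004HeegnerKolyvagin, Def. 2.1.10, Thm. 2.1.11]
[cite: PoonenRains2012, Prop. 4.10].
-/

noncomputable section

open scoped Classical NumberField
open Function NumberField IsDedekindDomain Field WeierstrassCurve
open Literature.NumberTheory.EllipticCurves Literature.NumberTheory.EllipticCurves.ModularForms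
open Literature.NumberTheory.GaloisRepresentations Literature.NumberTheory.GaloisRepresentations.DiscreteGaloisModule
  Literature.NumberTheory.GaloisCohomology
open Summit.BirchSwinnertonDyer.Rank1Residual.X11b.FiniteDuality
open Summit.BirchSwinnertonDyer.Rank1Residual.X11b.Relaxation
open Summit.BirchSwinnertonDyer.Rank1Residual.X11b
open Summit.BirchSwinnertonDyer.Rank1Residual.GaloisImage
open Summit.BirchSwinnertonDyer.Rank1Residual.X11b.Three.Koly.Method2

namespace Summit.BirchSwinnertonDyer.Rank1Residual.X11b.Three.Koly.ZhangSupply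

-- Cup products need `LocallyCompactSpace Γ`; finiteness of `E[n]`: local instances (as in the tree's cup-product files).
attribute [local instance] absoluteGaloisGroup_compactSpace finite_geomTorsion_of_neZero
  Literature.NumberTheory.EllipticCurves.finite_muCarrier

/-! ## §1 A local condition that is isotropic and has `#L² = #H¹(K_v, E[n])` is Lagrangian -/

section Lagrangian

variable {K : Type} [Field K] [NumberField K] (E : WeierstrassCurve K) [E.IsElliptic] (n : ℕ) [NeZero n]
variable (e : E.geomTorsion n → E.geomTorsion n → AlgebraicClosure K)
  (hμ : ∀ S T, e S T ^ n = 1)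
  (hadd₁ : ∀ S₁ S₂ T, e (S₁ + S₂) T = e S₁ T * e S₂ T)
  (hadd₂ : ∀ S T₁ T₂, e S (T₁ + T₂) = e S T₁ * e S T₂)
  (hgal : ∀ (σ : absoluteGaloisGroup K) (S T : E.geomTorsion n), σ • e S T = e (σ • S) (σ • T))
  (hnondeg : ∀ T, (∀ S, e S T = 1) → T = 0)
  (inv : LocalInvariants K n)

include hnondeg in
/-- **Isotropy + half the size ⟹ Lagrangian.** At a finite place `v` with `inv_v` injective, a local condition
`L ≤ H¹(K_v, E[n])` which is isotropic for the local Weil cup product `∪ₑ` and satisfies `#L · #L = #H¹(K_v, E[n])` is its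
own right annihilator under `inv_v(· ∪ₑ ·)`: isotropy gives `L ≤ L^⊥`, local Tate duality (right kernel trivial,
`invWeilPairing_flip_bijective`) gives `#L^⊥ · #L = #H¹` (`natCard_annRight_mul`), so `#L^⊥ = #L`.
[cite: MilneADT2006, Ch. I, Cor. 2.3 and Cor. 3.4] [cite: PoonenRains2012, Prop. 4.10] -/
theorem annRight_invWeilPairing_eq_of_isotropic_of_card (v : HeightOneSpectrum (𝓞 K))
    (hinv : Injective (inv (Sum.inr v))) (L : AddSubgroup (galoisCohomology ((E.torsionGaloisModule n).toLocal
      (Sum.inr v)) 1))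
    (hiso : ∀ a ∈ L, ∀ b ∈ L, (weilContPairingLocal E n e hμ hadd₁ hadd₂ hgal (Sum.inr v)).cupProduct a b = 0)
    (hcard : Nat.card L * Nat.card L = Nat.card (galoisCohomology ((E.torsionGaloisModule n).toLocal (Sum.inr v)) 1)) :
    annRight (invWeilPairing E n e hμ hadd₁ hadd₂ hgal inv (Sum.inr v)) L = L := by
  haveI := KummerPT.finite_galoisCohomology_toLocal_inr E n v
  set b := invWeilPairing E n e hμ hadd₁ hadd₂ hgal inv (Sum.inr v) with hb
  have hA := KummerPT.nsmul_galoisCohomology_toLocal_eq_zero E n (Sum.inr v)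
  -- isotropy: `L ≤ L^⊥`
  have hle : L ≤ annRight b L := fun y hy ↦ (mem_annRight_iff b L y).mpr fun x hx ↦ by
    rw [hb, invWeilPairing_apply, hiso x hx y hy]
    exact map_zero _
  -- counting
  have hmul : Nat.card (annRight b L) * Nat.card L =
      Nat.card (galoisCohomology ((E.torsionGaloisModule n).toLocal (Sum.inr v)) 1) :=
    natCard_annRight_mul hA b (KummerPT.invWeilPairing_flip_bijective E n e hμ hadd₁ hadd₂ hgal hnondeg inv v hinv) L
  have hLpos : 0 < Nat.card L := Nat.card_pos
  have hcard' : Nat.card (annRight b L) = Nat.card L :=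
    Nat.eq_of_mul_eq_mul_right hLpos (hmul.trans hcard.symm)
  exact (AddSubgroup.eq_of_le_of_card_ge hle hcard'.le).symm

end Lagrangian

/-! ## §2 The (J) binder from the two local Lagrangian inputs -/

variable (W : WeierstrassCurve ℚ) (K : Type) [Field K] [NumberField K] [W.IsElliptic] [W.IsGloballyMinimal]
  (ι : K →+* ℂ)

/-- **`hjump` from (Lag-ord) + (Lag-tr) modulo Poitou–Tate.** See the module docstring. Binders: `hK` (the infinite
place is complex; `#H¹(K_λ, E[3]) = 81`); the named PT fact `hPT`; the places `plK` of the Kolyvagin primes (`hplK`);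
the two families of genuine local conditions `Lord`, `Ltr` (Poitou–Tate model) with, for each: isotropy for the local
Weil cup product of EVERY Weil-type pairing `e` on `E[3]`, the count `#L · #L = #H¹(K_v, E[3])`, and the one-sided
dictionary with the tree's global-currency condition (`ordinaryLocalKer` ∕ `Method2.transverseLocalKer`) — asked only
above GOOD unipotent-admissible primes (`FrobSqNeOneAt`), resp. at the places `plK ℓ′`. Conclusion: the binder `hjump`
of `supply_signed_of_jump_bound` VERBATIM. [cite: WZhang2014, Lemma 8.2] [cite: McCallumLMS1991, Prop. 2.1]
[cite: MilneADT2006, Ch. I, Thm. 4.10, Cor. 3.4] -/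
theorem hjump_of_localLagrangians (hK : IsImaginaryQuadratic K) (hPT : poitouTate_selmerStructure_duality K)
    (plK : {ℓ // Zhang2014.IsKolyvaginPrime (W.conductorNorm ℤ) W K 3 ℓ} → HeightOneSpectrum (𝓞 K))
    (hplK : ∀ ℓ, ((ℓ : ℕ) : 𝓞 K) ∈ (plK ℓ).asIdeal)
    (Lord Ltr : (v : HeightOneSpectrum (𝓞 K)) →
      AddSubgroup (galoisCohomology (((W.baseChange K).torsionGaloisModule ((3 ^ 1 : ℕ) : ℤ)).toLocal (Sum.inr v)) 1))
    -- (Lag-ord): above good unipotent-admissible primes, `Lord v` is isotropic, of half size, inside the ordinary condition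
    (hordIso : ∀ (q : {q // IsUAdmissiblePrime W K q}), FrobSqNeOneAt W 3 q.1 →
      ∀ (v : HeightOneSpectrum (𝓞 K)), ((q : ℕ) : 𝓞 K) ∈ v.asIdeal →
      ∀ (e : geomTorsion (W.baseChange K) ((3 ^ 1 : ℕ) : ℤ) → geomTorsion (W.baseChange K) ((3 ^ 1 : ℕ) : ℤ) →
          AlgebraicClosure K)
        (hμ : ∀ P Q, e P Q ^ (3 ^ 1) = 1) (hadd₁ : ∀ P₁ P₂ Q, e (P₁ + P₂) Q = e P₁ Q * e P₂ Q)
        (hadd₂ : ∀ P Q₁ Q₂, e P (Q₁ + Q₂) = e P Q₁ * e P Q₂) (_halt : ∀ Q, e Q Q = 1)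
        (_hnondeg : ∀ Q, (∀ P, e P Q = 1) → Q = 0)
        (hgal : ∀ (σ : absoluteGaloisGroup K) (P Q : geomTorsion (W.baseChange K) ((3 ^ 1 : ℕ) : ℤ)),
          σ • e P Q = e (σ • P) (σ • Q)),
      ∀ a ∈ Lord v, ∀ b ∈ Lord v,
        (weilContPairingLocal (W.baseChange K) (3 ^ 1) e hμ hadd₁ hadd₂ hgal (Sum.inr v)).cupProduct a b = 0)
    (hordCard : ∀ (q : {q // IsUAdmissiblePrime W K q}), FrobSqNeOneAt W 3 q.1 →
      ∀ (v : HeightOneSpectrum (𝓞 K)), ((q : ℕ) : 𝓞 K) ∈ v.asIdeal →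
      Nat.card (Lord v) * Nat.card (Lord v) =
        Nat.card (galoisCohomology (((W.baseChange K).torsionGaloisModule ((3 ^ 1 : ℕ) : ℤ)).toLocal (Sum.inr v)) 1))
    (hordIncl : ∀ (q : {q // IsUAdmissiblePrime W K q}), FrobSqNeOneAt W 3 q.1 →
      ∀ (v : HeightOneSpectrum (𝓞 K)), ((q : ℕ) : 𝓞 K) ∈ v.asIdeal → ∀ x : V3 W K,
      galoisCohomology.localization ((W.baseChange K).torsionGaloisModule ((3 ^ 1 : ℕ) : ℤ)) (Sum.inr v) 1 x ∈
        Lord v → x ∈ (W.baseChange K).ordinaryLocalKer (v.adicCompletion K) ((3 ^ 1 : ℕ) : ℤ))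
    -- (Lag-tr): at the place of every Kolyvagin prime, `Ltr` is isotropic, of half size, inside the transverse condition
    (htrIso : ∀ (ℓ' : {ℓ // Zhang2014.IsKolyvaginPrime (W.conductorNorm ℤ) W K 3 ℓ})
      (e : geomTorsion (W.baseChange K) ((3 ^ 1 : ℕ) : ℤ) → geomTorsion (W.baseChange K) ((3 ^ 1 : ℕ) : ℤ) →
          AlgebraicClosure K)
        (hμ : ∀ P Q, e P Q ^ (3 ^ 1) = 1) (hadd₁ : ∀ P₁ P₂ Q, e (P₁ + P₂) Q = e P₁ Q * e P₂ Q)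
        (hadd₂ : ∀ P Q₁ Q₂, e P (Q₁ + Q₂) = e P Q₁ * e P Q₂) (_halt : ∀ Q, e Q Q = 1)
        (_hnondeg : ∀ Q, (∀ P, e P Q = 1) → Q = 0)
        (hgal : ∀ (σ : absoluteGaloisGroup K) (P Q : geomTorsion (W.baseChange K) ((3 ^ 1 : ℕ) : ℤ)),
          σ • e P Q = e (σ • P) (σ • Q)),
      ∀ a ∈ Ltr (plK ℓ'), ∀ b ∈ Ltr (plK ℓ'),
        (weilContPairingLocal (W.baseChange K) (3 ^ 1) e hμ hadd₁ hadd₂ hgal (Sum.inr (plK ℓ'))).cupProduct a b = 0)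
    (htrCard : ∀ (ℓ' : {ℓ // Zhang2014.IsKolyvaginPrime (W.conductorNorm ℤ) W K 3 ℓ}),
      Nat.card (Ltr (plK ℓ')) * Nat.card (Ltr (plK ℓ')) =
        Nat.card (galoisCohomology (((W.baseChange K).torsionGaloisModule ((3 ^ 1 : ℕ) : ℤ)).toLocal
          (Sum.inr (plK ℓ'))) 1))
    (htrIncl : ∀ (ℓ' : {ℓ // Zhang2014.IsKolyvaginPrime (W.conductorNorm ℤ) W K 3 ℓ}) (x : V3 W K),
      galoisCohomology.localization ((W.baseChange K).torsionGaloisModule ((3 ^ 1 : ℕ) : ℤ)) (Sum.inr (plK ℓ')) 1 x ∈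
        Ltr (plK ℓ') → x ∈ transverseLocalKer W K ι ℓ' (plK ℓ')) :
    ∀ (n : Finset {q // IsUAdmissiblePrime W K q}), GoodLevel W K n → n.Nonempty →
      ∀ (ℓ : {ℓ // Zhang2014.IsKolyvaginPrime (W.conductorNorm ℤ) W K 3 ℓ}) (T : Finset _), ℓ ∉ T →
      ∀ x₀ : V3 W K, ∃ x : V3 W K,
        ((∀ w : InfinitePlace K, x ∈ selmerLocalKer (W.baseChange K) w.Completion ((3 ^ 1 : ℕ) : ℤ)) ∧
          (∀ v : HeightOneSpectrum (𝓞 K), v ≠ plK ℓ → (∀ ℓ' ∈ T, plK ℓ' ≠ v) →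
            ((∀ q ∈ n, ((q : ℕ) : 𝓞 K) ∉ v.asIdeal) →
              x ∈ selmerLocalKer (W.baseChange K) (v.adicCompletion K) ((3 ^ 1 : ℕ) : ℤ)) ∧
            (∀ q ∈ n, ((q : ℕ) : 𝓞 K) ∈ v.asIdeal →
              x ∈ (W.baseChange K).ordinaryLocalKer (v.adicCompletion K) ((3 ^ 1 : ℕ) : ℤ))) ∧
          (∀ ℓ' ∈ T, x ∈ transverseLocalKer W K ι ℓ' (plK ℓ'))) ∧
        ∀ a : ℤ, x - a • x₀ ∉ (W.baseChange K).torsionLocalKer ((plK ℓ).adicCompletion K) ((3 ^ 1 : ℕ) : ℤ) := by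
  intro n hg _hn ℓ T hℓT
  haveI : Fact (Nat.Prime 3) := ⟨Nat.prime_three⟩
  haveI : NeZero (3 ^ 1 : ℕ) := ⟨by norm_num⟩
  haveI : IsTotallyComplex K := hK.2
  have hKc : ∀ w : InfinitePlace K, w.IsComplex := fun w ↦ IsTotallyComplex.isComplex w
  -- a Weil pairing on `E[3]` and the Poitou–Tate family at level `3`
  obtain ⟨e, hμ, hadd₁, hadd₂, halt, hnondeg, hgal⟩ :=
    exists_weilPairing_holds (W.baseChange K) (3 ^ 1) (by norm_num) (by norm_num)
  obtain ⟨inv, hperf, hsum, -, hcompl⟩ := hPT (3 ^ 1)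
  have hinj : ∀ v : HeightOneSpectrum (𝓞 K), Injective (inv (Sum.inr v)) := fun v ↦ (hperf v).1.1
  -- separation of the places: `λ ∉ plK(T)`, no Kolyvagin place lies above a prime of the level
  have hKK : ∀ ℓ' ∈ T, plK ℓ' ≠ plK ℓ := by
    intro ℓ' hℓ' h
    have hne : (ℓ' : ℕ) ≠ ℓ := fun h' ↦ hℓT (Subtype.ext h' ▸ hℓ')
    have hcop : Nat.Coprime (ℓ : ℕ) (ℓ' : ℕ) := (Nat.coprime_primes ℓ.2.1 ℓ'.2.1).mpr (Ne.symm hne)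
    exact not_mem_asIdeal_of_coprime K hcop (plK ℓ) (hplK ℓ) (h ▸ hplK ℓ')
  have hKU : ∀ (ℓ' : {ℓ // Zhang2014.IsKolyvaginPrime (W.conductorNorm ℤ) W K 3 ℓ})
      (q : {q // IsUAdmissiblePrime W K q}), ((q : ℕ) : 𝓞 K) ∉ (plK ℓ').asIdeal :=
    fun ℓ' q ↦ not_mem_of_kolyvagin_place W K q.2 ℓ'.2 (plK ℓ') (hplK ℓ')
  -- the exceptional finite set `T'` of finite places: above `3`, bad, `λ`, `plK(T)`, above the level
  have h30 : (Ideal.span {((3 : ℕ) : 𝓞 K)} : Ideal (𝓞 K)) ≠ 0 := by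
    rw [Ne, Ideal.zero_eq_bot, Ideal.span_singleton_eq_bot]
    exact_mod_cast Nat.prime_three.ne_zero
  have h3fin : {v : HeightOneSpectrum (𝓞 K) | ((3 : ℕ) : 𝓞 K) ∈ v.asIdeal}.Finite :=
    (Ideal.finite_factors h30).subset fun v hv ↦ (Ideal.dvd_span_singleton).mpr hv
  have hbadfin : {v : HeightOneSpectrum (𝓞 K) | ¬ (W.baseChange K).HasGoodReductionAt v}.Finite := by
    have h := (W.baseChange K).eventually_hasGoodReductionAt
    rwa [Filter.eventually_cofinite] at h
  have hnfin : {v : HeightOneSpectrum (𝓞 K) | ∃ q ∈ n, ((q : ℕ) : 𝓞 K) ∈ v.asIdeal}.Finite := by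
    have hq : ∀ q : {q // IsUAdmissiblePrime W K q},
        {v : HeightOneSpectrum (𝓞 K) | ((q : ℕ) : 𝓞 K) ∈ v.asIdeal}.Finite := by
      intro q
      have hq0 : (Ideal.span {((q : ℕ) : 𝓞 K)} : Ideal (𝓞 K)) ≠ 0 := by
        rw [Ne, Ideal.zero_eq_bot, Ideal.span_singleton_eq_bot]
        exact_mod_cast q.2.1.ne_zero
      exact (Ideal.finite_factors hq0).subset fun v hv ↦ (Ideal.dvd_span_singleton).mpr hv
    refine ((n : Set {q // IsUAdmissiblePrime W K q}).toFinite.biUnion fun q _ ↦ hq q).subset ?_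
    intro v hv
    obtain ⟨q, hqn, hqv⟩ := hv
    exact Set.mem_biUnion (Finset.mem_coe.mpr hqn) hqv
  set T' : Finset (HeightOneSpectrum (𝓞 K)) :=
    h3fin.toFinset ∪ hbadfin.toFinset ∪ {plK ℓ} ∪ T.image plK ∪ hnfin.toFinset with hT'
  have h3T' : ∀ v : HeightOneSpectrum (𝓞 K), ((3 : ℕ) : 𝓞 K) ∈ v.asIdeal → v ∈ T' := fun v hv ↦ by
    apply Finset.mem_union_left; apply Finset.mem_union_left; apply Finset.mem_union_left
    apply Finset.mem_union_left
    exact h3fin.mem_toFinset.mpr hv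
  have hbadT' : ∀ v : HeightOneSpectrum (𝓞 K), ¬ (W.baseChange K).HasGoodReductionAt v → v ∈ T' := fun v hv ↦ by
    apply Finset.mem_union_left; apply Finset.mem_union_left; apply Finset.mem_union_left
    apply Finset.mem_union_right
    exact hbadfin.mem_toFinset.mpr hv
  have hlamT' : plK ℓ ∈ T' := by
    apply Finset.mem_union_left; apply Finset.mem_union_left; apply Finset.mem_union_right
    exact Finset.mem_singleton_self _
  have hTT' : ∀ ℓ' ∈ T, plK ℓ' ∈ T' := fun ℓ' hℓ' ↦ by
    apply Finset.mem_union_left; apply Finset.mem_union_right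
    exact Finset.mem_image_of_mem plK hℓ'
  have hnT' : ∀ v : HeightOneSpectrum (𝓞 K), ∀ q ∈ n, ((q : ℕ) : 𝓞 K) ∈ v.asIdeal → v ∈ T' := fun v q hq hqv ↦ by
    apply Finset.mem_union_right
    exact hnfin.mem_toFinset.mpr ⟨q, hq, hqv⟩
  -- outside `T'`: `3 ∉ v`, good reduction, not `λ`, not a `T`-place, above no prime of the level
  have hout3 : ∀ v : HeightOneSpectrum (𝓞 K), v ∉ T' → ((3 : ℕ) : 𝓞 K) ∉ v.asIdeal := fun v hv h ↦ hv (h3T' v h)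
  have houtgood : ∀ v : HeightOneSpectrum (𝓞 K), v ∉ T' → (W.baseChange K).HasGoodReductionAt v := fun v hv ↦ by
    by_contra h
    exact hv (hbadT' v h)
  have houtlam : ∀ v : HeightOneSpectrum (𝓞 K), v ∉ T' → v ≠ plK ℓ := fun v hv h ↦ hv (h ▸ hlamT')
  have houtT : ∀ v : HeightOneSpectrum (𝓞 K), v ∉ T' → ¬ ∃ ℓ' ∈ T, plK ℓ' = v :=
    fun v hv ⟨ℓ', hℓ', h⟩ ↦ hv (h ▸ hTT' ℓ' hℓ')
  have houtn : ∀ v : HeightOneSpectrum (𝓞 K), v ∉ T' → ¬ ∃ q ∈ n, ((q : ℕ) : 𝓞 K) ∈ v.asIdeal :=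
    fun v hv ⟨q, hq, hqv⟩ ↦ hv (hnT' v q hq hqv)
  -- the two structures: `s = true` relaxed at `λ`, `s = false` strict at `λ`
  set 𝓚 : SelmerStructure ((W.baseChange K).torsionGaloisModule ((3 ^ 1 : ℕ) : ℤ)) :=
    (W.baseChange K).kummerSelmerStructure ((3 ^ 1 : ℕ) : ℤ) with h𝓚
  let str : Bool → SelmerStructure ((W.baseChange K).torsionGaloisModule ((3 ^ 1 : ℕ) : ℤ)) := fun s v ↦
    match v with
    | Sum.inl w => 𝓚 (Sum.inl w)
    | Sum.inr v =>
      if v = plK ℓ then (bif s then ⊤ else ⊥)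
      else if (∃ ℓ' ∈ T, plK ℓ' = v) then Ltr v
      else if (∃ q ∈ n, ((q : ℕ) : 𝓞 K) ∈ v.asIdeal) then Lord v
      else 𝓚 (Sum.inr v)
  have hstr_inl : ∀ s (w : InfinitePlace K), str s (Sum.inl w) = 𝓚 (Sum.inl w) := fun _ _ ↦ rfl
  have hstr_inr : ∀ s (v : HeightOneSpectrum (𝓞 K)), str s (Sum.inr v) =
      if v = plK ℓ then (bif s then ⊤ else ⊥)
      else if (∃ ℓ' ∈ T, plK ℓ' = v) then Ltr v
      else if (∃ q ∈ n, ((q : ℕ) : 𝓞 K) ∈ v.asIdeal) then Lord v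
      else 𝓚 (Sum.inr v) := fun _ _ ↦ rfl
  -- values at each kind of finite place
  have hstr_lam : ∀ s, str s (Sum.inr (plK ℓ)) = (bif s then ⊤ else ⊥) := fun s ↦ by
    rw [hstr_inr, if_pos rfl]
  have hstr_T : ∀ s, ∀ ℓ' ∈ T, str s (Sum.inr (plK ℓ')) = Ltr (plK ℓ') := fun s ℓ' hℓ' ↦ by
    rw [hstr_inr, if_neg (hKK ℓ' hℓ'), if_pos ⟨ℓ', hℓ', rfl⟩]
  have hstr_n : ∀ s (v : HeightOneSpectrum (𝓞 K)), v ≠ plK ℓ → (∀ ℓ' ∈ T, plK ℓ' ≠ v) →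
      ∀ q ∈ n, ((q : ℕ) : 𝓞 K) ∈ v.asIdeal → str s (Sum.inr v) = Lord v := fun s v hv hvT q hq hqv ↦ by
    rw [hstr_inr, if_neg hv, if_neg (fun ⟨ℓ', hℓ', h⟩ ↦ hvT ℓ' hℓ' h), if_pos ⟨q, hq, hqv⟩]
  have hstr_K : ∀ s (v : HeightOneSpectrum (𝓞 K)), v ≠ plK ℓ → (¬ ∃ ℓ' ∈ T, plK ℓ' = v) →
      (¬ ∃ q ∈ n, ((q : ℕ) : 𝓞 K) ∈ v.asIdeal) → str s (Sum.inr v) = 𝓚 (Sum.inr v) := fun s v hv hvT hvn ↦ by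
    rw [hstr_inr, if_neg hv, if_neg hvT, if_neg hvn]
  have hstr_out : ∀ s (v : HeightOneSpectrum (𝓞 K)), v ∉ T' → str s (Sum.inr v) = 𝓚 (Sum.inr v) :=
    fun s v hv ↦ hstr_K s v (houtlam v hv) (houtT v hv) (houtn v hv)
  -- the side conditions of part XIV
  have hS : ∀ v : HeightOneSpectrum (𝓞 K), v ∉ T' → (((3 ^ 1 : ℕ) : ℕ) : 𝓞 K) ∉ v.asIdeal ∧
      GaloisRep.IsUnramifiedAt v ((W.baseChange K).torsionGaloisModule (3 ^ 1 : ℕ)) := by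
    intro v hv
    have h3 : ((3 ^ 1 : ℕ) : 𝓞 K) ∉ v.asIdeal := by
      rw [pow_one]
      exact hout3 v hv
    refine ⟨h3, ?_⟩
    exact AcSelmer.isUnramifiedAt_torsionGaloisModule (W.baseChange K) (houtgood v hv)
      (n := ((3 ^ 1 : ℕ) : ℤ)) (by rw [Int.cast_natCast]; exact h3)
  have hunr : ∀ s, (str s).IsUnramifiedOutside (finSupport T') := by
    intro s
    refine ⟨fun w ↦ inl_mem_finSupport T' w, fun v hv ↦ ?_⟩
    rw [inr_mem_finSupport_iff] at hv
    rw [hstr_out s v hv, h𝓚]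
    exact KummerPT.kummerSelmerStructure_inr_eq_unramifiedSubgroup (W.baseChange K) 3 1
      (by exact_mod_cast hout3 v hv) (houtgood v hv)
  have heq : ∀ v : Place K, v ≠ Sum.inr (plK ℓ) → str false v = str true v := by
    intro v hv
    rcases v with w | v
    · rfl
    · have hv' : v ≠ plK ℓ := fun h ↦ hv (h ▸ rfl)
      rw [hstr_inr, hstr_inr, if_neg hv', if_neg hv']
  have hstrict : str false (Sum.inr (plK ℓ)) = ⊥ := hstr_lam false
  have hrelax : str true (Sum.inr (plK ℓ)) = ⊤ := hstr_lam true
  -- finiteness: `H¹_{str false} ⊆ H¹_{𝓚 relaxed on S(T')} = kummerOutside`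
  have hfin : Finite (str false).selmerGroup := by
    have hle : (str false).selmerGroup ≤ (KummerPT.kummerRelaxed (W.baseChange K) (3 ^ 1) (finSupport T')).selmerGroup := by
      intro x hx
      rw [SelmerStructure.mem_selmerGroup_iff] at hx ⊢
      intro v
      rcases v with w | v
      · rw [KummerPT.kummerRelaxed_of_mem _ _ _ (inl_mem_finSupport T' w)]
        exact AddSubgroup.mem_top _
      · by_cases hvT : v ∈ T'
        · rw [KummerPT.kummerRelaxed_of_mem _ _ _ ((inr_mem_finSupport_iff T' v).mpr hvT)]
          exact AddSubgroup.mem_top _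
        · rw [KummerPT.kummerRelaxed_of_not_mem _ _ _ (fun h ↦ hvT ((inr_mem_finSupport_iff T' v).mp h))]
          have h := hx (Sum.inr v)
          rw [hstr_out false v hvT, h𝓚] at h
          exact h
    haveI : Finite (KummerPT.kummerRelaxed (W.baseChange K) (3 ^ 1) (finSupport T')).selmerGroup := by
      rw [KummerPT.selmerGroup_kummerRelaxed]
      exact SelmerLevelBound.finite_kummerOutside (W.baseChange K) (3 ^ 1) (finSupport T')
    exact Finite.of_injective (AddSubgroup.inclusion hle) (AddSubgroup.inclusion_injective hle)
  -- the Lagrangian property off `λ`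
  have h31 : IsPrimePow (3 ^ 1 : ℕ) := Nat.prime_three.isPrimePow.pow one_ne_zero
  have hEP : ∀ v : HeightOneSpectrum (𝓞 K), localEulerPoincareCharacteristic (v.adicCompletion K) := fun v ↦ by
    haveI : CharZero (v.adicCompletion K) := charZero_of_injective_algebraMap (algebraMap K _).injective
    exact localEulerPoincareCharacteristic_holds (v.adicCompletion K)
  have hmaxK : ∀ v : Place K, annRight (invWeilPairing (W.baseChange K) (3 ^ 1 : ℕ) e hμ hadd₁ hadd₂ hgal inv v)
      (𝓚 v) = 𝓚 v := fun v ↦ by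
    rw [h𝓚]
    exact KummerDuality.annRight_invWeilPairing_kummerSelmerStructure_eq (W.baseChange K) (3 ^ 1) e hμ hadd₁ hadd₂
      hgal halt hnondeg inv hKc h31 hperf hEP v
  have hmax : ∀ v : Place K, v ≠ Sum.inr (plK ℓ) →
      annRight (invWeilPairing (W.baseChange K) (3 ^ 1 : ℕ) e hμ hadd₁ hadd₂ hgal inv v) (str false v) =
        str false v := by
    intro v hv
    rcases v with w | v
    · rw [hstr_inl false w]
      exact hmaxK (Sum.inl w)
    · have hv' : v ≠ plK ℓ := fun h ↦ hv (h ▸ rfl)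
      by_cases hvT : ∃ ℓ' ∈ T, plK ℓ' = v
      · obtain ⟨ℓ', hℓ', rfl⟩ := hvT
        rw [hstr_T false ℓ' hℓ']
        exact annRight_invWeilPairing_eq_of_isotropic_of_card (W.baseChange K) (3 ^ 1) e hμ hadd₁ hadd₂ hgal hnondeg
          inv (plK ℓ') (hinj _) (Ltr (plK ℓ')) (htrIso ℓ' e hμ hadd₁ hadd₂ halt hnondeg hgal) (htrCard ℓ')
      · by_cases hvn : ∃ q ∈ n, ((q : ℕ) : 𝓞 K) ∈ v.asIdeal
        · obtain ⟨q, hq, hqv⟩ := hvn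
          rw [hstr_n false v hv' (fun ℓ' hℓ' h ↦ hvT ⟨ℓ', hℓ', h⟩) q hq hqv]
          exact annRight_invWeilPairing_eq_of_isotropic_of_card (W.baseChange K) (3 ^ 1) e hμ hadd₁ hadd₂ hgal
            hnondeg inv v (hinj v) (Lord v) (hordIso q (hg q hq) v hqv e hμ hadd₁ hadd₂ halt hnondeg hgal)
            (hordCard q (hg q hq) v hqv)
        · rw [hstr_K false v hv' hvT hvn]
          exact hmaxK (Sum.inr v)
  -- `#H¹(K_λ, E[3]) = 81 > 9` (part XVII)
  have hw := nine_lt_natCard_galoisCohomology_one_toLocal_of_kolyvagin W K hK ℓ.2 (plK ℓ) (hplK ℓ)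
  -- the dictionary `H¹_{str true} ⊆ G(n, ℓ, T)` (part XVI)
  have hincl := selmerGroup_subset_relaxedGroup W K ι plK n ℓ T (str true)
    (fun w ↦ by rw [hstr_inl true w, h𝓚, WeierstrassCurve.kummerSelmerStructure_apply]; exact le_rfl)
    (fun v hv hvT hvn ↦ by
      rw [hstr_K true v hv (fun ⟨ℓ', hℓ', h⟩ ↦ hvT ℓ' hℓ' h) (fun ⟨q, hq, hqv⟩ ↦ hvn q hq hqv), h𝓚,
        WeierstrassCurve.kummerSelmerStructure_apply]
      exact le_rfl)
    (fun v hv hvT q hq hqv x hx ↦ by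
      rw [hstr_n true v hv hvT q hq hqv] at hx
      exact hordIncl q (hg q hq) v hqv x hx)
    (fun ℓ' hℓ' x hx ↦ by
      rw [hstr_T true ℓ' hℓ'] at hx
      exact htrIncl ℓ' x hx)
  -- assemble (part XIV)
  exact hjump_of_lagrangian W K ι plK n ℓ T e hμ hadd₁ hadd₂ hgal hnondeg inv hperf hsum hcompl T' hS (hunr false)
    (hunr true) ⟨plK ℓ, hlamT'⟩ rfl heq hstrict hrelax hfin hmax hw hincl

end Summit.BirchSwinnertonDyer.Rank1Residual.X11b.Three.Koly.ZhangSupply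

end
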